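import Literature.NumberTheory.GaloisRepresentations.DecompositionGroupOfCompletion
import Literature.RingTheory.DiscreteValuationRing.AdicCompletionHensel
import Literature.RingTheory.DiscreteValuationRing.AdicCompletionResidueField
import Mathlib.NumberTheory.NumberField.Ideal.Basic
import HarnessLib

/-!
# Units, roots and the discrete value group of `K_v` and of its finite extensions

Topic `NumberTheory/GaloisRepresentations`; theorems only (no definition, no named fact), in the
setting of `DecompositionGroupOfCompletion`: `K` a number field, `v` a finite place,
`K_v = v.adicCompletion K` with its `v`-adic norm `‖·‖` (values `q_v^ℤ ∪ {0}`,
`q_v = N v = #(𝓞 K ⧸ v)`), `\bar K_v = AlgebraicClosure K_v` with the spectral norm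
`|·| = spectralNorm K_v \bar K_v` (Mathlib).  Elementary facts of the arithmetic of the complete
discretely valued field `K_v` used by the rigidity theorem for decomposition fields
(`DecompositionFieldRigidity.lean`):

* `exists_norm_eq_zpow` — `‖y‖ = q_v ^ n`, `n ∈ ℤ`, for `y ≠ 0` in `K_v`;
* `exists_spectralNorm_pow_factorial_eq_zpow` — for `t ≠ 0` in a finite subextension
  `k' ⊆ \bar K_v` of `K_v`, `|t| ^ [k' : K_v]! = q_v ^ m` for some `m ∈ ℤ`
  (`|t|^{deg t} = ‖a₀‖`, `a₀` the constant coefficient of the minimal polynomial);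
* `spectralNorm_eq_one_of_forall_exists_pow_eq` — hence an element of `k'` admitting `ℓ^n`-th
  roots in `k'` for every `n` (`ℓ` a prime) has `|t| = 1`: the value group of `k'` is discrete;
* `exists_prime_isUnit_natCast` — there is a prime `ℓ` invertible in `O_v` (any prime different
  from the residue characteristic);
* `exists_pow_eq_of_norm_sub_one_lt` — **Hensel**: a principal unit `y` (`‖y - 1‖ < 1`) of `K_v`
  is an `m`-th power in `K_v` whenever `m` is invertible in `O_v` (tree:
  `adicCompletionIntegers.henselianLocalRing`, Neukirch II (4.6));
* `exists_pos_forall_norm_pow_sub_one_lt` — there is `n ≥ 1` with `‖y ^ n - 1‖ < 1` for every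
  unit `y` (`‖y‖ = 1`) of `K_v` (`n = #κ(v)^×`, finiteness of the residue field).

## References

* J. Neukirch, *Algebraic Number Theory*, Grundlehren 322 (1999), Ch. II §3–§5 (Hensel's lemma
  (4.6); structure of the unit group (5.3), (5.7)). [NeukirchANT1999]
* J.-P. Serre, *Local Fields*, GTM 67 (1979), Ch. II §3 Cor. 3 (uniqueness/discreteness of the
  extended valuation), Ch. II §4 Prop. 8. [SerreLocalFields1979]
-/

noncomputable section

open scoped NumberField Valued
open Field IsDedekindDomain Polynomial

universe u

namespace Literature.NumberTheory.GaloisRepresentations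

variable (K : Type u) [Field K] [NumberField K] (v : HeightOneSpectrum (𝓞 K))

/-! ### The value group of `K_v` -/

/-- `1 < q_v = N v` as a real number (the absolute norm of a nonzero prime of `𝓞 K`).
Neukirch, *Algebraic Number Theory*, Ch. I §6 (6.1). [cite: NeukirchANT1999, Ch. I §6 Prop. (6.1)] -/
theorem one_lt_absNorm_real : (1 : ℝ) < (Ideal.absNorm v.asIdeal : ℕ) := by
  exact_mod_cast NumberField.HeightOneSpectrum.one_lt_absNorm v

/-- **The value group of `K_v` is `q_v^ℤ`**: every `y ≠ 0` in `K_v` has `‖y‖ = q_v ^ n` for some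
integer `n` (the norm is `q_v^{-ord_v}`).  Neukirch, *Algebraic Number Theory*, Ch. II §5.
[cite: NeukirchANT1999, Ch. II §5 Prop. (5.2)] -/
theorem exists_norm_eq_zpow {y : v.adicCompletion K} (hy : y ≠ 0) :
    ∃ n : ℤ, ‖y‖ = ((Ideal.absNorm v.asIdeal : ℕ) : ℝ) ^ n := by
  rw [NumberField.FinitePlace.norm_def]
  have hv0 : Valued.v y ≠ 0 := (Valuation.ne_zero_iff _).mpr hy
  rw [WithZeroMulInt.toNNReal_neg_apply _ hv0]
  exact ⟨_, by push_cast; rfl⟩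

/-- There is an element of the number field `K` of norm in `(0, 1)` in `K_v` which generates the
value group: `‖ϖ‖ = q_v⁻¹` (a uniformiser of `v`). Neukirch, *Algebraic Number Theory*, Ch. II §5.
[cite: NeukirchANT1999, Ch. II §5 Prop. (5.2)] -/
theorem exists_norm_algebraMap_eq_inv :
    ∃ ϖ : K, ‖algebraMap K (v.adicCompletion K) ϖ‖ = (((Ideal.absNorm v.asIdeal : ℕ) : ℝ))⁻¹ := by
  obtain ⟨ϖ, hϖ⟩ := v.valuation_exists_uniformizer K
  refine ⟨ϖ, ?_⟩
  have hval : Valued.v (algebraMap K (v.adicCompletion K) ϖ) = WithZero.exp (-1 : ℤ) :=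
    (HeightOneSpectrum.valuedAdicCompletion_eq_valuation' v ϖ).trans hϖ
  rw [NumberField.FinitePlace.norm_def, hval]
  have h0 : (WithZero.exp (-1 : ℤ) : WithZero (Multiplicative ℤ)) ≠ 0 := WithZero.coe_ne_zero
  rw [WithZeroMulInt.toNNReal_neg_apply _ h0]
  push_cast
  rw [show Multiplicative.toAdd (WithZero.unzero h0) = (-1 : ℤ) from rfl, zpow_neg, zpow_one]

/-! ### The value group of a finite extension of `K_v` is discrete -/

section Spectral

variable (k' : IntermediateField (v.adicCompletion K) (AlgebraicClosure (v.adicCompletion K)))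
  [FiniteDimensional (v.adicCompletion K) k']

/-- For `t ≠ 0` in a finite subextension `k'` of `K_v` inside `\bar K_v`,
`|t| ^ ([k' : K_v]!) = q_v ^ m` for some integer `m` (`|t|^{deg} = ‖a₀‖_v`, `a₀` the constant
coefficient of the minimal polynomial of `t`; Mathlib `spectralNorm_eq_norm_coeff_zero_rpow`).
Serre, *Local Fields*, Ch. II §2 Cor. 3. [cite: SerreLocalFields1979, Ch. II §2 Cor. 3] -/
theorem exists_spectralNorm_pow_factorial_eq_zpow {t : AlgebraicClosure (v.adicCompletion K)}
    (ht : t ∈ k') (ht0 : t ≠ 0) :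
    ∃ m : ℤ, spectralNorm (v.adicCompletion K) (AlgebraicClosure (v.adicCompletion K)) t ^
        (Module.finrank (v.adicCompletion K) k').factorial =
      ((Ideal.absNorm v.asIdeal : ℕ) : ℝ) ^ m := by
  set k := v.adicCompletion K
  have hint : IsIntegral k t := Algebra.IsIntegral.isIntegral t
  have hdpos : 0 < (minpoly k t).natDegree := minpoly.natDegree_pos hint
  have hdle : (minpoly k t).natDegree ≤ Module.finrank k k' := by
    rw [← IntermediateField.minpoly_eq (⟨t, ht⟩ : k')]
    exact minpoly.natDegree_le _
  obtain ⟨r, hr⟩ := Nat.dvd_factorial hdpos hdle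
  have ha0 : (minpoly k t).coeff 0 ≠ 0 := minpoly.coeff_zero_ne_zero hint ht0
  have hnorm : spectralNorm k (AlgebraicClosure k) t ^ (minpoly k t).natDegree =
      ‖(minpoly k t).coeff 0‖ := by
    rw [spectralNorm.spectralNorm_eq_norm_coeff_zero_rpow k (AlgebraicClosure k) t, one_div,
      Real.rpow_inv_natCast_pow (norm_nonneg _) hdpos.ne']
  obtain ⟨n, hn⟩ := exists_norm_eq_zpow K v ha0
  refine ⟨n * r, ?_⟩
  rw [hr, pow_mul, hnorm, hn, ← zpow_natCast, ← zpow_mul]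

/-- **Discreteness of the value group of a finite extension of `K_v`**: an element `t` of a finite
subextension `k' ⊆ \bar K_v` of `K_v` which admits an `ℓ^n`-th root in `k'` for every `n` (`ℓ` a
prime) has spectral norm `1`.  Serre, *Local Fields*, Ch. II §2 Cor. 3 (the extended valuation is
discrete). [cite: SerreLocalFields1979, Ch. II §2 Cor. 3] -/
theorem spectralNorm_eq_one_of_forall_exists_pow_eq {ℓ : ℕ} (hℓ : ℓ.Prime)
    {t : AlgebraicClosure (v.adicCompletion K)} (ht : t ∈ k') (ht0 : t ≠ 0)
    (hdiv : ∀ n : ℕ, ∃ s ∈ k', s ^ (ℓ ^ n) = t) :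
    spectralNorm (v.adicCompletion K) (AlgebraicClosure (v.adicCompletion K)) t = 1 := by
  set k := v.adicCompletion K
  set q : ℝ := ((Ideal.absNorm v.asIdeal : ℕ) : ℝ) with hq
  have hD : (Module.finrank k k').factorial ≠ 0 := Nat.factorial_ne_zero _
  obtain ⟨m, hm⟩ := exists_spectralNorm_pow_factorial_eq_zpow K v k' ht ht0
  have hq1 : (1 : ℝ) < q := one_lt_absNorm_real K v
  have hq0 : (0 : ℝ) < q := lt_trans zero_lt_one hq1
  -- every power of `ℓ` divides `m`
  have hdvd : ∀ n : ℕ, ((ℓ ^ n : ℕ) : ℤ) ∣ m := by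
    intro n
    obtain ⟨s, hs, hst⟩ := hdiv n
    have hN : 0 < ℓ ^ n := pow_pos hℓ.pos n
    have hs0 : s ≠ 0 := by
      rintro rfl
      rw [zero_pow hN.ne'] at hst
      exact ht0 hst.symm
    obtain ⟨m', hm'⟩ := exists_spectralNorm_pow_factorial_eq_zpow K v k' hs hs0
    have key : q ^ m = q ^ (m' * (ℓ ^ n : ℕ)) := by
      rw [← hm, ← hst, isPowMul_spectralNorm s hN, ← pow_mul, mul_comm (ℓ ^ n), pow_mul, hm',
        ← zpow_natCast, ← zpow_mul]
    exact ⟨m', by rw [zpow_right_injective₀ hq0 hq1.ne' key, mul_comm]⟩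
  have hm0 : m = 0 := by
    refine Int.eq_zero_of_dvd_of_natAbs_lt_natAbs (hdvd m.natAbs) ?_
    rw [Int.natAbs_natCast]
    exact Nat.lt_pow_self hℓ.one_lt
  rw [hm0, zpow_zero] at hm
  exact (pow_left_inj₀ (spectralNorm_nonneg t) zero_le_one hD).mp (by rw [hm, one_pow])

end Spectral

/-! ### Units and principal units of `K_v`; Hensel's lemma for `X ^ m - y` -/

/-- There is a prime number `ℓ` which is a unit of `O_v` (any prime other than the residue
characteristic of `v`; the residue field `κ(v)` is finite of prime characteristic).
Neukirch, *Algebraic Number Theory*, Ch. II §5 (the residue class field is finite).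
[cite: NeukirchANT1999, Ch. II §5 Prop. (5.3)] -/
theorem exists_prime_isUnit_natCast :
    ∃ ℓ : ℕ, ℓ.Prime ∧ IsUnit ((ℓ : ℕ) : v.adicCompletionIntegers K) := by
  set O := v.adicCompletionIntegers K
  set F := IsLocalRing.ResidueField O
  set p := ringChar F
  haveI : CharP F p := ringChar.charP F
  -- `F` is a finite field, so its characteristic is a prime
  have hp : p.Prime := CharP.char_is_prime F p
  obtain ⟨ℓ, hℓ, hℓp⟩ : ∃ ℓ : ℕ, ℓ.Prime ∧ ℓ ≠ p := by
    by_cases h : p = 2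
    · exact ⟨3, Nat.prime_three, by omega⟩
    · exact ⟨2, Nat.prime_two, fun h' => h h'.symm⟩
  refine ⟨ℓ, hℓ, ?_⟩
  have hF : ((ℓ : ℕ) : F) ≠ 0 := by
    rw [Ne, CharP.cast_eq_zero_iff F p]
    intro hdvd
    exact hℓp ((Nat.prime_dvd_prime_iff_eq hp hℓ).mp hdvd).symm
  by_contra hunit
  apply hF
  have hmem : ((ℓ : ℕ) : O) ∈ IsLocalRing.maximalIdeal O := hunit
  rw [← map_natCast (IsLocalRing.residue O), IsLocalRing.residue_eq_zero_iff]
  exact hmem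

/-- The maximal ideal of `O_v` consists of the elements of norm `< 1` (`𝔭_v = {x : |x|_v < 1}`).
Neukirch, *Algebraic Number Theory*, Ch. II §3 (3.8). [cite: NeukirchANT1999, Ch. II §3 Prop. (3.8)] -/
theorem mem_maximalIdeal_adicCompletionIntegers_iff {x : v.adicCompletionIntegers K} :
    x ∈ IsLocalRing.maximalIdeal (v.adicCompletionIntegers K) ↔
      ‖(x : v.adicCompletion K)‖ < 1 := by
  rw [Valued.toNormedField.norm_lt_one_iff]
  exact Valuation.mem_maximalIdeal_iff (v.adicCompletion K) (Valued.v)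

/-- **Hensel's lemma for `X ^ m - y`**: if `y ∈ K_v` satisfies `‖y - 1‖ < 1` and `m` is invertible
in `O_v`, then `y` is an `m`-th power in `K_v` (the polynomial `X^m - y` has the simple root `1`
modulo `𝔪_v`; `O_v` is henselian, tree `adicCompletionIntegers.henselianLocalRing`).
Neukirch, *Algebraic Number Theory*, Ch. II (4.6). [cite: NeukirchANT1999, Ch. II §4 Lemma (4.6)] -/
theorem exists_pow_eq_of_norm_sub_one_lt {y : v.adicCompletion K} (hy : ‖y - 1‖ < 1) {m : ℕ}
    (hm : IsUnit ((m : ℕ) : v.adicCompletionIntegers K)) :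
    ∃ r : v.adicCompletion K, r ^ m = y := by
  set O := v.adicCompletionIntegers K
  -- `y` is a `v`-adic integer
  have hy1 : ‖y‖ ≤ 1 := by
    have e : y = (y - 1) + 1 := by ring
    rw [e]
    exact (IsUltrametricDist.norm_add_le_max _ _).trans (max_le hy.le (by rw [norm_one]))
  have hyO : y ∈ O :=
    (HeightOneSpectrum.mem_adicCompletionIntegers (𝓞 K) K v).mpr
      (Valued.toNormedField.norm_le_one_iff.mp hy1)
  set y' : O := ⟨y, hyO⟩
  have hsub : y' - 1 ∈ IsLocalRing.maximalIdeal O :=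
    (mem_maximalIdeal_adicCompletionIntegers_iff K v).mpr (by simpa [y'] using hy)
  -- Hensel for the monic polynomial `X ^ m - y'` at `a₀ = 1`
  set f : O[X] := X ^ m - C y' with hf
  have hm0 : m ≠ 0 := by
    rintro rfl
    simp at hm
  have hmonic : f.Monic := monic_X_pow_sub_C y' hm0
  have heval : f.eval 1 ∈ IsLocalRing.maximalIdeal O := by
    have : f.eval 1 = -(y' - 1) := by simp [hf]
    rw [this]
    exact neg_mem hsub
  have hderiv : IsUnit (f.derivative.eval 1) := by
    have : f.derivative.eval 1 = (m : O) := by simp [hf, derivative_X_pow]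
    rwa [this]
  obtain ⟨a, ha, -⟩ := HenselianLocalRing.is_henselian f hmonic 1 heval hderiv
  refine ⟨(a : v.adicCompletion K), ?_⟩
  have : a ^ m = y' := by
    have h := ha
    rw [IsRoot.def, hf, eval_sub, eval_pow, eval_X, eval_C, sub_eq_zero] at h
    exact h
  simpa [y'] using congrArg (fun z : O => (z : v.adicCompletion K)) this

/-- **Units have a power which is a principal unit**: there is `n ≥ 1` (the order of the unit group
of the residue field `κ(v)`) such that `‖y ^ n - 1‖ < 1` for every `y ∈ K_v` with `‖y‖ = 1`.
Neukirch, *Algebraic Number Theory*, Ch. II §3 (Prop. (3.10): `U / U^{(1)} ≅ κ^×`).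
[cite: NeukirchANT1999, Ch. II §3 Prop. (3.10)] -/
theorem exists_pos_forall_norm_pow_sub_one_lt :
    ∃ n : ℕ, 0 < n ∧ ∀ y : v.adicCompletion K, ‖y‖ = 1 → ‖y ^ n - 1‖ < 1 := by
  set O := v.adicCompletionIntegers K
  set F := IsLocalRing.ResidueField O
  haveI : Finite Fˣ := inferInstance
  refine ⟨Nat.card Fˣ, Nat.card_pos, fun y hy => ?_⟩
  have hyO : y ∈ O :=
    (HeightOneSpectrum.mem_adicCompletionIntegers (𝓞 K) K v).mpr
      (Valued.toNormedField.norm_le_one_iff.mp hy.le)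
  set y' : O := ⟨y, hyO⟩
  -- `y'` is a unit of `O`
  have hres : IsLocalRing.residue O y' ≠ 0 := by
    rw [Ne, IsLocalRing.residue_eq_zero_iff]
    intro h
    have h2 : ‖y‖ < 1 := by
      simpa [y'] using (mem_maximalIdeal_adicCompletionIntegers_iff K v).mp h
    exact absurd hy h2.ne
  set u : Fˣ := Units.mk0 _ hres
  have hu : (IsLocalRing.residue O y') ^ Nat.card Fˣ = 1 := by
    have h1 : u ^ Nat.card Fˣ = 1 := pow_card_eq_one'
    have h2 := congrArg ((↑) : Fˣ → F) h1
    rw [Units.val_pow_eq_pow_val, Units.val_one] at h2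
    exact h2
  have hmem : y' ^ Nat.card Fˣ - 1 ∈ IsLocalRing.maximalIdeal O := by
    rw [← IsLocalRing.residue_eq_zero_iff, map_sub, map_pow, map_one, hu, sub_self]
  simpa [y'] using (mem_maximalIdeal_adicCompletionIntegers_iff K v).mp hmem

end Literature.NumberTheory.GaloisRepresentations
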